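import Literature.NumberTheory.EllipticCurves.MultiplicativeRamifiedTorsionProofs
import Literature.NumberTheory.EllipticCurves.MultiplicativeUnipotentTorsionProofs
import Literature.NumberTheory.EllipticCurves.BSDSelmerPConverseUnipotentProofs
import Literature.NumberTheory.EllipticCurves.BSDSelmerPConverseProofs
import Literature.NumberTheory.EllipticCurves.BSDSelmerParityDokchitserBaseChangeProofs
import Literature.NumberTheory.EllipticCurves.RootNumberTwistProofs
import Literature.NumberTheory.EllipticCurves.SzpiroLocalDataProofs
import Literature.NumberTheory.EllipticCurves.QuadraticTwistProofs
import Literature.NumberTheory.EllipticCurves.BSDConductorProofs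
import Literature.NumberTheory.DiophantineGeometry.EllArithGlue
import Literature.NumberTheory.DiophantineGeometry.ConductorExponentLeFiveProofs
import HarnessLib

/-!
# `(sur_ℚ) + (ram) ⟹ (sur)` for every prime, and Thm. 1.10 of Burungale–Skinner–Tian–Wan
# assembled from its deep leaves alone

Family `bsd`, companion to `Literature.NumberTheory.EllipticCurves.BSDSelmer` (bsd.S25),
`BSDSelmerPConverse` and `BSDSelmerPConverseProofs`.  The latter assembles the verbatim named fact
`burungaleSkinnerTianWan_analyticRank_eq_one_of_selmerCorank_eq_one` (A. Burungale, C. Skinner,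
Y. Tian, X. Wan, *Zeta elements for elliptic curves and applications*, arXiv:2409.01350,
**Thm. 1.10**) from the printed leaves (a)–(f) of the proof of Thm. 12.3 / Thm. 12.11 (Part II,
§12; "Thm. 4.3 / Thm. 4.11" of the held TeX-derived text — see the locator erratum under References)
**plus** two image-of-Galois inputs converting the introduction's hypothesis (sur_ℚ)
("`ρ̄_{E,p}` surjective") into Part II's `p`-adic (sur): Serre's lifting lemma for `p ≥ 5`
(`serre_hasSurjectiveModNGaloisRep_pow`, since PROVED in the tree:
`serre_hasSurjectiveModNGaloisRep_pow_holds`) and, at `p = 3`, an un-vendored special case of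
C. Wuthrich, Doc. Math. 19 (2014), Lemma 20 (hypothesis `hW3`; Wuthrich's proof rests on Elkies'
explicit parametrisation of the exotic `3`-adic images by a modular curve of level `9`).

This file removes both: it PROVES that the hypotheses (sur_ℚ) and (ram) of Thm. 1.10 together
imply (sur) **for every prime `p`** —

* `hasSurjectiveModNGaloisRep_pow_of_hasMultiplicativeReductionAtPrime`: for `W/ℚ` elliptic and
  globally minimal and a prime `p`, if `ρ̄_{E,p}` is onto and there is a prime `ℓ ≠ p` of
  multiplicative reduction with `p ∤ v_ℓ(Δ_min)` (the tree's Tate-curve transcription of (ram):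
  "`ℓ ‖ N` and `ρ̄_{E,p}` ramified at `ℓ`"), then `ρ̄_{E,p^n}` is onto for every `n`

— so that (ram), which in the paper serves the Iwasawa theory ((irr_L), the choice of auxiliary
levels), also does the group theory at `p = 3`: the inertia group at `ℓ` supplies a transvection
`(1 1; 0 1)` in the image of `ρ̄_{E,p^n}` (Tate curve; here from Kodaira–Néron and Hensel, tree
files `MultiplicativeRamifiedTorsionProofs`, `MultiplicativeUnipotentTorsionProofs`), and a
subgroup of `GL₂(ℤ/p^n)` mapping onto `GL₂(𝔽_p)`, with full determinant, containing a transvection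
is everything for **all** `p` (`SL2TransvectionLifting`, `BSDSelmerPConverseUnipotentProofs`),
whereas Serre's `p`-th power argument needs `p ≥ 5` (Elkies: `ρ̄_{E,3}` onto does not imply
`ρ̄_{E,9}` onto in general).  Consequently —

* `burungaleSkinnerTianWan_analyticRank_eq_one_of_selmerCorank_eq_one_of_leaves`: **Thm. 1.10
  exactly as printed follows from the five deep printed leaves alone**: (a) the `p`-parity
  theorem (`p_parity`, Dokchitser–Dokchitser 2010), (b) the Friedberg–Hoffstein auxiliary
  imaginary quadratic field (`friedbergHoffstein_exists_heegnerField_split_twist_ne_zero`),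
  (c) Kato's finiteness theorem (`kato_finite_of_L_one_ne_zero`), (e) the `p`-converse over the
  auxiliary field (`burungaleSkinnerTianWan_analyticRankEK_eq_one_of_selmerCorank_eq_one`:
  Kato's main conjecture + the Heegner main conjecture + Gross–Zagier, the paper's Thm. 12.9 /
  Prop. 12.10) and (f) modularity (`hasEntireLFunction_rat`); leaf (d), Selmer coranks under
  quadratic base change, is the tree THEOREM `selmerCorank_baseChange_quadratic_holds`, and the
  passage (sur_ℚ) ⟹ (sur) is the theorem above.  No hypothesis on the image of Galois beyond the
  printed (sur_ℚ), (ram) remains, for any `p`.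

Also recorded: the ℚ-form of the Tate-curve dictionary used by the transcriptions of (ram) in
bsd.S21/S25/S30 (`WeierstrassCurve.exists_inertia_smul_ne_of_hasMultiplicativeReductionAtPrime`:
for `W/ℚ` globally minimal with multiplicative reduction at `ℓ` and `p ∤ v_ℓ(Δ_min)`, `ℓ ≠ p`,
some element of the inertia group at `ℓ` moves some `p`-torsion point of `E(\bar{ℚ_ℓ})`, i.e.
`ρ̄_{E,p}` IS ramified at `ℓ`).

## References

* [BurungaleSkinnerTianWan2024] A. Burungale, C. Skinner, Y. Tian, X. Wan, *Zeta elements for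
  elliptic curves and applications*, arXiv:2409.01350v2 (2024), PRINTED numbering and arXiv v2 PDF
  pages: Thm. 1.10 (p. 5); (ram) in Thm. 9.21(c) (p. 84); (sur) in Thm. 9.26 (p. 86); §12
  (pp. 95–98): Thm. 12.3 and its proof (p. 96), Thm. 12.9, Prop. 12.10, Thm. 12.11 (p. 98).
  LOCATOR ERRATUM (2026-08-25, checked against the arXiv v2 PDF): earlier revisions of this file
  gave these as "Part II (sur), (ram) (p. 74), §4 (pp. 82–84)" with Thm. 4.3 / 4.9 / 4.11 and
  Prop. 4.10 — the numbering of the held TeX-derived text (`lit read arxiv:2409.01350`, 88 chunks),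
  whose "p. N" are chunk indices and whose extraction restarts the section counter inside each
  Part (Part II: held §s = printed §(s+8)); the paper itself numbers §1–§12 continuously. The
  quoted words are unchanged by the erratum.
* [SerreAbelianLadic1968] J.-P. Serre, *Abelian `ℓ`-adic representations and elliptic curves*
  (1968): Ch. IV §3.4, Lemma 3 (lifting); Ch. IV, A.1.2 (inertia at a multiplicative place acts
  through `(1 *; 0 1)`, as quoted by Silverman, *ATAEC*, Exercise 5.13(b), PDF p. 416, and its
  notes, PDF p. 441, of the held copy).
* [Wuthrich2014] C. Wuthrich, Doc. Math. 19 (2014), Lemma 20 (the input replaced here).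
* [SilvermanATAEC1994] J. H. Silverman, *Advanced Topics in the Arithmetic of Elliptic Curves*,
  GTM 151 (1994): Cor. IV.9.2(d) (PDF p. 340), V.4–V.5, Exercise 5.13(b) (PDF p. 416).
-/

noncomputable section

open scoped Classical NNReal
open NumberField IsDedekindDomain

universe u

/-! ## The ℚ-form of "multiplicative reduction with `p ∤ v_ℓ(Δ_min)` ⟹ `ρ̄_{E,p}` ramified at `ℓ`" -/

namespace WeierstrassCurve

open Literature.NumberTheory.EllipticCurves Literature.NumberTheory.GaloisRepresentations Field
  IsDedekindDomain.HeightOneSpectrum Rat.HeightOneSpectrum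

set_option maxHeartbeats 1600000 in
/-- **Over `ℚ`: multiplicative reduction at `ℓ` with `p ∤ v_ℓ(Δ_min)` ⟹ the inertia group at
`ℓ` moves a `p`-torsion point** (the Tate-curve transcription of "`ρ̄_{E,p}` is ramified at
`ℓ ‖ N`" used in bsd.S21/S25/S30 implies the printed hypothesis; Silverman, *ATAEC*,
V.4–V.5 and Exercise 5.13(b)).  For `W/ℚ` elliptic and globally minimal, `v` the place of `𝓞 ℚ`
over the prime `ℓ = primesEquiv v`, `p ≠ ℓ` a prime with `p ∤ v_ℓ(Δ_min)`
(`WeierstrassCurve.minimalDiscriminantInt`), multiplicative reduction at `ℓ`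
(`WeierstrassCurve.HasMultiplicativeReductionAtPrime`), and `𝔐` the prime of `\\bar 𝓞_v`
above `𝓂_v`: some `σ ∈ I_𝔐 ≤ Γ_{ℚ_v}` moves some `Q ∈ E(\\bar{ℚ_v})`
(`localPoints W (v.adicCompletion ℚ)`) with `p Q = O`.  Proof: `W` is minimal at `v`, so
multiplicative reduction reads `v(Δ(W)) < 1`, `v(c₄(W)) = 1`; the `ℤ`-model `integralModelInt W`
pushed to `𝓞_v` has `c₄ ∈ 𝓞_v^×` and `Δ = Δ_min = d' ℓ^n`, `ℓ ∤ d'`, `n = v_ℓ(Δ_min) ≥ 1`, with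
`ℓ` a uniformiser of `𝓞_v`; apply
`IsDedekindDomain.HeightOneSpectrum.exists_inertia_map_ne_of_multiplicative` and transport to
`E(\\bar{ℚ_v})` (`exists_addEquiv_localPoints_of_smul_eq`).
[cite: SilvermanATAEC1994, Cor. IV.9.2(d), V.4–V.5 and Exercise 5.13(b) (PDF p. 416)] [cite: SerreAbelianLadic1968, Ch. IV, A.1.2] -/
theorem exists_inertia_smul_ne_of_hasMultiplicativeReductionAtPrime
    (W : WeierstrassCurve ℚ) [W.IsElliptic] [W.IsGloballyMinimal] (v : HeightOneSpectrum (𝓞 ℚ))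
    {p : ℕ} (hp : p.Prime) (hℓp : (primesEquiv v : ℕ) ≠ p)
    (hmult : haveI := Fact.mk (primesEquiv v).2; W.HasMultiplicativeReductionAtPrime (primesEquiv v))
    (hram : ¬ p ∣ padicValNat (primesEquiv v) W.minimalDiscriminantInt.natAbs)
    {w : Valuation (AlgebraicClosure (v.adicCompletion ℚ)) ℝ≥0}
    (hw : ∀ x, (w x : ℝ) =
      spectralNorm (v.adicCompletion ℚ) (AlgebraicClosure (v.adicCompletion ℚ)) x)
    {𝔐 : Ideal v.localAbsIntegers} (h𝔐 : 𝔐 ∈ v.localPrimesAbove) :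
    ∃ σ ∈ 𝔐.inertia (absoluteGaloisGroup (v.adicCompletion ℚ)),
      ∃ Q : localPoints W (v.adicCompletion ℚ), p • Q = 0 ∧ σ • Q ≠ Q := by
  set ℓ : ℕ := (primesEquiv v : ℕ) with hℓdef
  have hℓ : ℓ.Prime := (primesEquiv v).2
  haveI hℓfact : Fact ℓ.Prime := ⟨hℓ⟩
  -- multiplicative reduction, read on the globally minimal `W`
  have hmin : W.IsMinimalAt v := IsGloballyMinimal.isMinimalAt W v
  have hmult' : W.HasMultiplicativeReductionAt v :=
    (hasMultiplicativeReductionAtPrime_iff_hasMultiplicativeReductionAt_ringOfIntegers W v).mp hmult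
  obtain ⟨hΔv, hc₄v⟩ := (hasMultiplicativeReductionAt_iff_of_isMinimalAt hmin).mp hmult'
  -- the minimal discriminant `d = d' ℓ^n`, `ℓ ∤ d'`, `n = v_ℓ(d)`
  set d : ℤ := W.minimalDiscriminantInt with hd
  have hd0 : d ≠ 0 := minimalDiscriminantInt_ne_zero W
  set n : ℕ := padicValNat ℓ d.natAbs with hndef
  have hdvd : ((ℓ : ℤ) ^ n) ∣ d := by
    rw [← Int.natCast_pow, Int.natCast_dvd]
    exact pow_padicValNat_dvd
  obtain ⟨d', hd'⟩ := hdvd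
  have hℓd' : ¬ (ℓ : ℤ) ∣ d' := by
    rintro ⟨e, rfl⟩
    have h1 : ((ℓ : ℤ) ^ (n + 1)) ∣ d := ⟨e, by rw [hd', pow_succ]; ring⟩
    rw [← Int.natCast_pow, Int.natCast_dvd] at h1
    exact pow_succ_padicValNat_not_dvd (Int.natAbs_ne_zero.mpr hd0) h1
  -- the `ℤ`-model pushed to `𝓞_v`
  set X₀ : WeierstrassCurve (v.adicCompletionIntegers ℚ) :=
    (integralModelInt W).map (Int.castRingHom (v.adicCompletionIntegers ℚ)) with hX₀
  have hX₀Δ : X₀.Δ = (d' : v.adicCompletionIntegers ℚ) * ((ℓ : ℕ) : v.adicCompletionIntegers ℚ) ^ n := by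
    rw [hX₀, map_Δ, eq_intCast]
    change ((minimalDiscriminantInt W : ℤ) : v.adicCompletionIntegers ℚ) = _
    rw [← hd, hd']
    push_cast
    ring
  -- valuations of integers at `v`
  have hval : ∀ z : ℤ, Valued.v ((z : v.adicCompletionIntegers ℚ) : v.adicCompletion ℚ) =
      v.valuation ℚ (z : ℚ) := by
    intro z
    have hcoe : ((z : v.adicCompletionIntegers ℚ) : v.adicCompletion ℚ) =
        algebraMap ℚ (v.adicCompletion ℚ) (z : ℚ) := by
      rw [map_intCast]; exact SubringClass.coe_intCast _ z
    rw [hcoe, IsDedekindDomain.HeightOneSpectrum.algebraMap_adicCompletion]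
    exact IsDedekindDomain.HeightOneSpectrum.valuedAdicCompletion_eq_valuation' v (z : ℚ)
  have hu : IsUnit (d' : v.adicCompletionIntegers ℚ) := by
    rw [IsDedekindDomain.HeightOneSpectrum.adicCompletionIntegers.isUnit_iff_valued_eq_one, hval]
    exact valuation_ringOfIntegers_intCast_eq_one v hℓd'
  have hπ : Irreducible ((ℓ : ℕ) : v.adicCompletionIntegers ℚ) :=
    Literature.NumberTheory.DiophantineGeometry.Rat.irreducible_natCast_natGenerator v
  have hWΔ : W.Δ = (d : ℚ) := by rw [hd, cast_minimalDiscriminantInt]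
  have hn1 : 1 ≤ n := by
    by_contra h0
    have hn0 : n = 0 := by omega
    have hdd' : d = d' := by rw [hd', hn0, pow_zero, one_mul]
    have h1 : v.valuation ℚ (d : ℚ) = 1 := by
      rw [hdd']; exact valuation_ringOfIntegers_intCast_eq_one v hℓd'
    rw [hWΔ, h1] at hΔv
    exact lt_irrefl _ hΔv
  have hc₄ : X₀.c₄ ∉ IsLocalRing.maximalIdeal (v.adicCompletionIntegers ℚ) := by
    intro hmem
    have hWc₄ : W.c₄ = ((integralModelInt W).c₄ : ℚ) := by
      conv_lhs => rw [← map_integralModelInt W]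
      rw [map_c₄, eq_intCast]
    have hunit : IsUnit X₀.c₄ := by
      rw [IsDedekindDomain.HeightOneSpectrum.adicCompletionIntegers.isUnit_iff_valued_eq_one, hX₀,
        map_c₄, eq_intCast, hval, ← hWc₄]
      exact hc₄v
    exact (IsLocalRing.mem_maximalIdeal _).mp hmem hunit
  have hpv : (p : 𝓞 ℚ) ∉ v.asIdeal := by
    intro hmem
    have hv := (natCast_mem_asIdeal_iff_eq_primesEquiv_symm v hp).mp hmem
    apply hℓp
    rw [hℓdef, hv, Equiv.apply_symm_apply]
  have hpn : ¬ p ∣ n := hram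
  -- the local statement, for `X₀(K̄_v)`
  obtain ⟨σ, hσ, P, hpP, hσP⟩ :=
    exists_inertia_map_ne_of_multiplicative hw X₀ hu hπ hn1 hX₀Δ hc₄ hp hpv hpn h𝔐
  -- transport to `E(\bar ℚ_v)`
  have hXW : (1 : VariableChange (v.adicCompletion ℚ)) • W.baseChange (v.adicCompletion ℚ) =
      X₀.baseChange (v.adicCompletion ℚ) := by
    rw [one_smul, hX₀]
    conv_lhs => rw [← map_integralModelInt W]
    simp only [baseChange, map_map]
    congr 1
    exact RingHom.ext_int _ _
  obtain ⟨Φ, hΦ⟩ := W.exists_addEquiv_localPoints_of_smul_eq v hXW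
  refine ⟨σ, hσ, Φ.symm P, ?_, fun h ↦ hσP ?_⟩
  · apply Φ.injective
    rw [map_nsmul, AddEquiv.apply_symm_apply, hpP, map_zero]
  · have := hΦ σ (Φ.symm P)
    rw [h, AddEquiv.apply_symm_apply] at this
    exact this.symm

end WeierstrassCurve

/-! ## `(sur_ℚ) + (ram) ⟹ (sur)` for every prime -/

namespace Literature.NumberTheory.EllipticCurves

-- NB: `open WeierstrassCurve` here would open the nested namespace
-- `Literature.NumberTheory.EllipticCurves.WeierstrassCurve` (from `ReductionHomomorphism`), so the
-- root `WeierstrassCurve` names are written in full.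
open Field IsDedekindDomain.HeightOneSpectrum

/-- **`ρ̄_{E,p}` onto and a prime `ℓ ‖ N` with `ρ̄_{E,p}` ramified at `ℓ` ⟹ `ρ̄_{E,p^n}` onto,
for every prime `p`.**  For an elliptic curve `W/ℚ` given by a globally minimal equation and a
prime `p`: if the mod-`p` representation is onto (`(sur_ℚ)` of Burungale–Skinner–Tian–Wan,
Thm. 1.10) and there is a prime `ℓ ≠ p` of multiplicative reduction with `p ∤ v_ℓ(Δ_min)` (the
tree's Tate-curve transcription of `(ram)`), then `ρ̄_{E,p^n} : Γ_ℚ → Aut(E[p^n])` is onto for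
every `n` — Part II's (sur) in the spelling of bsd.S20.  Proof: at the place `v` over `ℓ` some
inertia element `τ` moves a `p`-torsion point
(`exists_inertia_smul_ne_of_hasMultiplicativeReductionAtPrime`) and the inertia group acts on
`E(\\bar{ℚ_v})[p^n]` with `(τ - 1)² = 0`
(`smul_smul_sub_eq_of_mem_inertia_of_hasMultiplicativeReductionAt`), so `σ = τ|_{ℚ̄}` is a
unipotent element of the image non-trivial modulo `p`
(`exists_unipotent_of_hasMultiplicativeReductionAt`), and
`hasSurjectiveModNGaloisRep_pow_of_unipotent` (transvection form of Serre's lifting lemma, all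
`p`) concludes.  For `p ≥ 5` this is also Serre's lemma (`serre_hasSurjectiveModNGaloisRep_pow_holds`,
without (ram)); at `p = 3` it replaces Wuthrich 2014, Lemma 20.
[cite: BurungaleSkinnerTianWan2024, Thm. 1.10 (p. 5) and (ram) in Thm. 9.21(c) (p. 84), (sur) in Thm. 9.26 (p. 86)]
[cite: SilvermanATAEC1994, Exercise 5.13(b) (PDF p. 416)] [cite: SerreAbelianLadic1968, Ch. IV §3.4 and A.1.2] -/
theorem hasSurjectiveModNGaloisRep_pow_of_hasMultiplicativeReductionAtPrime
    (W : WeierstrassCurve ℚ) [W.IsElliptic] [W.IsGloballyMinimal] (p : ℕ) [Fact p.Prime]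
    (hsurj : W.HasSurjectiveModNGaloisRep p)
    (hram : ∃ ℓ : ℕ, ∃ _ : Fact ℓ.Prime, ℓ ≠ p ∧ W.HasMultiplicativeReductionAtPrime ℓ ∧
      ¬ p ∣ padicValInt ℓ W.minimalDiscriminantInt) (n : ℕ) :
    W.HasSurjectiveModNGaloisRep (p ^ n : ℕ) := by
  have hp : p.Prime := Fact.out
  rcases Nat.eq_zero_or_pos n with rfl | hn
  · haveI : Subsingleton (WeierstrassCurve.geomTorsion W ((p ^ 0 : ℕ) : ℤ)) := ⟨fun a b ↦ by
      have ha := AddSubgroup.torsionBy.nsmul_iff.mp a.2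
      have hb := AddSubgroup.torsionBy.nsmul_iff.mp b.2
      simp only [pow_zero, one_smul] at ha hb
      exact Subtype.ext (ha.trans hb.symm)⟩
    intro y
    exact ⟨1, Multiplicative.toAdd.injective (AddEquiv.ext fun a ↦ Subsingleton.elim _ _)⟩
  · obtain ⟨ℓ, hℓ, hℓp, hmult, hdiv⟩ := hram
    set v : HeightOneSpectrum (𝓞 ℚ) :=
      (Rat.HeightOneSpectrum.primesEquiv (R := 𝓞 ℚ)).symm ⟨ℓ, hℓ.out⟩ with hvdef
    have hv : Rat.HeightOneSpectrum.primesEquiv v = ⟨ℓ, hℓ.out⟩ := Equiv.apply_symm_apply _ _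
    have hvℓ : (Rat.HeightOneSpectrum.primesEquiv v : ℕ) = ℓ := congrArg Subtype.val hv
    obtain ⟨w, hw⟩ := v.exists_spectralValuation
    obtain ⟨𝔐, h𝔐⟩ := v.localPrimesAbove_nonempty
    -- the hypotheses at the place `v`
    have hmult_v : haveI := Fact.mk (Rat.HeightOneSpectrum.primesEquiv v).2;
        W.HasMultiplicativeReductionAtPrime (Rat.HeightOneSpectrum.primesEquiv v) := by
      have key : ∀ (q : ℕ) (hq : Fact q.Prime), q = ℓ →
          @WeierstrassCurve.HasMultiplicativeReductionAtPrime W q hq := by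
        rintro q hq rfl; exact hmult
      exact key _ _ hvℓ
    have hram_v : ¬ p ∣ padicValNat (Rat.HeightOneSpectrum.primesEquiv v)
        W.minimalDiscriminantInt.natAbs := by
      rw [hvℓ]; exact hdiv
    have hℓp' : (Rat.HeightOneSpectrum.primesEquiv v : ℕ) ≠ p := by rw [hvℓ]; exact hℓp
    have hloc := W.exists_inertia_smul_ne_of_hasMultiplicativeReductionAtPrime v hp hℓp' hmult_v hram_v
      hw h𝔐
    have hmultAt : W.HasMultiplicativeReductionAt v :=
      (WeierstrassCurve.hasMultiplicativeReductionAtPrime_iff_hasMultiplicativeReductionAt_ringOfIntegers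
        W v).mp hmult_v
    have hpv : (p : 𝓞 ℚ) ∉ v.asIdeal := by
      intro hmem
      have hv' := (natCast_mem_asIdeal_iff_eq_primesEquiv_symm v hp).mp hmem
      apply hℓp'
      rw [hv', Equiv.apply_symm_apply]
    have hU := W.exists_unipotent_of_hasMultiplicativeReductionAt hmultAt hp hpv hn hw h𝔐 hloc
    exact hasSurjectiveModNGaloisRep_pow_of_unipotent W p hsurj n hU

/-! ## Thm. 1.10 of Burungale–Skinner–Tian–Wan from its deep leaves alone -/

/-- **Burungale–Skinner–Tian–Wan, arXiv:2409.01350, Thm. 1.10 exactly as printed, assembled from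
the deep printed leaves alone** ("Let `E/ℚ` be an elliptic curve of conductor `N`, and `p ∤ 2N` an
ordinary prime. Suppose that […] (sur_ℚ) The mod `p` Galois representation
`ρ̄ : G_ℚ → Aut_{𝔽_p} E[p]` is surjective. (ram) There exists a prime `ℓ ‖ N` such that `ρ̄` is
ramified at `ℓ`. Then `corank_{ℤ_p} Sel_{p^∞}(E/ℚ) = 1 ⟹ ord_{s=1} L(s, E/ℚ) = 1`", p. 5;
the tree's named fact `burungaleSkinnerTianWan_analyticRank_eq_one_of_selmerCorank_eq_one`).
Hypotheses: (a) the `p`-parity theorem (`hpar`, tree `p_parity`), (b) the Friedberg–Hoffstein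
field (`hFH`), (c) Kato's finiteness theorem (`hKato`, tree `kato_finite_of_L_one_ne_zero`),
(e) the `p`-converse over the auxiliary imaginary quadratic field (`hL`,
`burungaleSkinnerTianWan_analyticRankEK_eq_one_of_selmerCorank_eq_one`: Kato's main conjecture +
Heegner main conjecture + Gross–Zagier, the deep input) and (f) modularity (`hE`, tree
`hasEntireLFunction_rat`).  Compared with
`burungaleSkinnerTianWan_analyticRank_eq_one_of_selmerCorank_eq_one_of_facts`
(`BSDSelmerPConverseProofs`): leaf (d) is the tree theorem
`selmerCorank_baseChange_quadratic_holds`, and the conversion (sur_ℚ) ⟹ (sur) — there Serre's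
lemma for `p ≥ 5` and Wuthrich's Lemma 20 at `p = 3` — is the theorem
`hasSurjectiveModNGaloisRep_pow_of_hasMultiplicativeReductionAtPrime`, valid for all `p` thanks
to (ram).  Then Thm. 12.11 (Part II) for an elliptic curve
(`analyticRank_eq_one_of_selmerCorank_eq_one_of_padicSurjective`) applies.
[cite: BurungaleSkinnerTianWan2024, Thm. 1.10 (p. 5) and Thm. 12.11 (p. 98) with the proof of Thm. 12.3 (p. 96)] -/
theorem burungaleSkinnerTianWan_analyticRank_eq_one_of_selmerCorank_eq_one_of_leaves
    (hpar : ∀ (W : WeierstrassCurve ℚ) [W.IsElliptic] (p : ℕ) [Fact p.Prime], p_parity W p)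
    (hFH : friedbergHoffstein_exists_heegnerField_split_twist_ne_zero)
    (hKato : ∀ (W : WeierstrassCurve ℚ) [W.IsElliptic] (p : ℕ) [Fact p.Prime],
      kato_finite_of_L_one_ne_zero W p)
    (hL : burungaleSkinnerTianWan_analyticRankEK_eq_one_of_selmerCorank_eq_one)
    (hE : WeierstrassCurve.hasEntireLFunction_rat) :
    burungaleSkinnerTianWan_analyticRank_eq_one_of_selmerCorank_eq_one := by
  intro W _ _ p _ hp2 hgood hord hsurj hram hcorank
  have hsur : ∀ n : ℕ, W.HasSurjectiveModNGaloisRep (p ^ n : ℕ) :=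
    hasSurjectiveModNGaloisRep_pow_of_hasMultiplicativeReductionAtPrime W p hsurj hram
  exact analyticRank_eq_one_of_selmerCorank_eq_one_of_padicSurjective hpar hFH hKato
    selmerCorank_baseChange_quadratic_holds hL hE W p hp2 hgood hord hsur hram hcorank

/-- The interim bsd.S25 statement `analyticRank_eq_one_of_selmerCorank_eq_one` from the same five
leaves (via `analyticRank_eq_one_of_selmerCorank_eq_one_of_bstw`).
[cite: BurungaleSkinnerTianWan2024, Thm. 1.10] -/
theorem analyticRank_eq_one_of_selmerCorank_eq_one_of_leaves
    (hpar : ∀ (W : WeierstrassCurve ℚ) [W.IsElliptic] (p : ℕ) [Fact p.Prime], p_parity W p)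
    (hFH : friedbergHoffstein_exists_heegnerField_split_twist_ne_zero)
    (hKato : ∀ (W : WeierstrassCurve ℚ) [W.IsElliptic] (p : ℕ) [Fact p.Prime],
      kato_finite_of_L_one_ne_zero W p)
    (hL : burungaleSkinnerTianWan_analyticRankEK_eq_one_of_selmerCorank_eq_one)
    (hE : WeierstrassCurve.hasEntireLFunction_rat) :
    analyticRank_eq_one_of_selmerCorank_eq_one :=
  analyticRank_eq_one_of_selmerCorank_eq_one_of_bstw
    (burungaleSkinnerTianWan_analyticRank_eq_one_of_selmerCorank_eq_one_of_leaves hpar hFH hKato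
      hL hE)

end Literature.NumberTheory.EllipticCurves

end
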